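import Mathlib
import HarnessLib
import Summits.NavierStokesRegularity.NavierStokesRegularity.Theses.TaoLadderRungOne
import Summits.NavierStokesRegularity.NavierStokesRegularity.Theorems.TaoLadderRungOneSplitCascadeIsAveragedNoDilOfSplit
import Summits.NavierStokesRegularity.NavierStokesRegularity.Theorems.TaoLadderRungOneSplitCascadeBlowup
import Summits.NavierStokesRegularity.NavierStokesRegularity.Theorems.TaoLadderRungOneCascadeNoDilOfSingleScaleAt
import Summits.NavierStokesRegularity.NavierStokesRegularity.Theorems.TaoLadderRungOneSplitCascadeIsAveragedNoDilStubSplitNoDilPackaging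
import Summits.NavierStokesRegularity.NavierStokesRegularity.Theorems.TaoLadderRungOneSingleScaleNoDilAt

/-!
# `TaoLadderRungOne.Target` — the rung-1 LEAF `M₁` of the TAO-LADDER (item stmt-NavierStokesRegularity-19871)

T. Tao, *Finite time blowup for an averaged three-dimensional Navier–Stokes equation*, J. Amer.
Math. Soc. **29** (2016) 601–674 = arXiv:1402.0290v3, Theorem 1.5 ⇐ Theorems 3.2 + 3.3 (p. 14),
§3 (the averaging class with dilations `λ`), §§4–6 (the cascade).

HONEST FRAMING (cell harvest/h2-tao-ladder, rung `M₁ = M₀ − (A-dil)`): a MODEL statement about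
Tao's averaged Navier–Stokes class — there is an averaging datum `𝒜 = (Ω, μ, m, R, λ)` with
`λ ≡ 1` (no dilation averaging), symmetric and cancelling, and a Schwartz divergence-free datum
with NO global mild `H¹⁰_df` solution of the averaged equation. Nothing here is a statement about
the true Navier–Stokes equations.

**Statement.** `Summit.NavierStokesRegularity.NavierStokesRegularity.Theses.TaoLadderRungOne.Target`.

PROOF. The route's deciding theorem `Theses.TaoLadderRungOne.closes :
SplitCascadeIsAveragedNoDil → SplitCascadeBlowup → Target` applied to the tree theorems that close
its two crux items: R1-b `splitCascadeBlowup_proof` (Theorems 6.2♯/4.2♯/3.3♯ for the split local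
cascade operator, `TaoLadderRungOneSplitCascadeBlowup.lean`) and R1-a by its gen-1 glued split
`taoLadderRungOne_splitCascadeIsAveragedNoDilOfSplit_proof` fed with K1
`taoLadderRungOne_singleScaleNoDilAt_proof` (§3.5–3.9 about a general gapped base triangle,
dilation-free), K2 `taoLadderRungOne_cascadeNoDilOfSingleScaleAt_proof` (§3.3–3.4 with `λ ≡ 1`)
and K3 `SplitCascadeIsAveragedNoDil.Split.stub_splitNoDilPackaging` (the packaging `C ↦ 𝒜`).
This is the referee's end-to-end term `c30_m1_target` (HOME referee/c30_m1_target_combo.lean,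
cycle 30, kernel-checked there) landed in the tree.
-/

noncomputable section

-- the sub-problem namespace repeats the summit name by design (D-0017)
set_option linter.dupNamespace false

namespace Summit.NavierStokesRegularity.NavierStokesRegularity.Theorems

open Summit.NavierStokesRegularity.NavierStokesRegularity.Theses.TaoLadderRungOne

/-- **Item stmt-NavierStokesRegularity-19871, the rung-1 leaf `M₁`** (MODEL statement — Tao's
averaged Navier–Stokes class WITHOUT dilation averaging blows up: some symmetric cancelling
averaging datum with `λ ≡ 1` and some Schwartz divergence-free datum admit no global mild
`H¹⁰_df` solution; nothing about the true Navier–Stokes equations): the route's deciding theorem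
`closes` applied to the proved crux theorems R1-a (by its glued split K1, K2, K3) and R1-b.
[cite: Tao2016AveragedNS, Thm 1.5 ⇐ Thms 3.2 + 3.3, p. 14] -/
theorem taoLadderRungOne_target_proof :
    Summit.NavierStokesRegularity.NavierStokesRegularity.Theses.TaoLadderRungOne.Target :=
  closes
    (taoLadderRungOne_splitCascadeIsAveragedNoDilOfSplit_proof
      taoLadderRungOne_singleScaleNoDilAt_proof
      taoLadderRungOne_cascadeNoDilOfSingleScaleAt_proof
      SplitCascadeIsAveragedNoDil.Split.stub_splitNoDilPackaging)
    splitCascadeBlowup_proof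

end Summit.NavierStokesRegularity.NavierStokesRegularity.Theorems

end
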